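import Summits.NavierStokesRegularity.NavierStokesRegularity.Theorems.ScalingDefectPeepholeDoorFrame
import Literature.Analysis.FluidPDE.NormalisedPressureSupBound
import Literature.Analysis.FluidPDE.NormalisedPressureAffine
import Literature.Analysis.FluidPDE.PoincareBall

/-!
# ScalingDefectPeepholeDoorPressureStein — door S30 «ScalingDefectPeepholeDoor», plate P4 (frame) part 2, step 1:
# the POINTWISE normalised-pressure bound with WEIGHTED far field, at any scale (ns-s29-p2 g2)

Input of `AnnularPressureBoundS30` (`ScalingDefectPeepholeDoorFrame`): the pointwise (1.16) bound on the window annulus needs a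
pointwise estimate of the Riesz/normalised pressure `p̃[v](x)` whose FAR FIELD keeps the weight `|x − y|⁻³` (so that local Type I
near the apex and the energy far away can be fed in), at the SCALE `δ ≍ λ/8` of the annulus (the tree's
`abs_normalisedPressure_le_of_local_bounds` is the unit-scale version with the crude far bound `∫|v|²/(2π)`).

* `abs_normalisedPressure_le_weighted` — for `v ∈ C¹(ℝ³)` with `∫|v|² < ∞`, `|v| ≤ M₀`, `‖Dv‖ ≤ M₁` on `B̄(x,1)`:
  `|p̃[v](x)| ≤ M₀²/3 + 8M₀M₁ + (2π)⁻¹ ∫_{|y−x|>1} |v(y)|²/|x−y|³`;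
* `abs_normalisedPressure_le_weighted_scale` — the same at scale `δ > 0` (affine covariance `normalisedPressure_comp_affine`):
  bounds on `B̄(x, δ)`, near term `8M₀M₁δ`, far term `(2π)⁻¹∫_{|y−x|>δ}|v|²/|x−y|³`.

WHAT THIS IS NOT: a generic harmonic-analysis step; `AnnularPressureBoundS30`, door S30, 0056 and NS regularity are untouched.
-/

noncomputable section

set_option linter.dupNamespace false

namespace Summit.NavierStokesRegularity.NavierStokesRegularity.Theorems.ScalingDefectPeepholeDoor

open MeasureTheory Set Function Filter Topology Metric
open scoped ENNReal
open Literature.Analysis Literature.Analysis.FluidPDE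

variable {v : EuclideanSpace ℝ (Fin 3) → EuclideanSpace ℝ (Fin 3)}

/-- the far truncated integral keeps the kernel weight: `|∫_{|x−y|>1} K(x−y)(v y)| ≤ (2π)⁻¹ ∫_{|y−x|>1} |v y|²/|x − y|³`. -/
theorem abs_truncatedPressureIntegral_one_le_weighted (hv : Continuous v) (hv2 : Integrable fun y => ‖v y‖ ^ 2)
    (x : EuclideanSpace ℝ (Fin 3)) :
    |truncatedPressureIntegral v x 1| ≤
      (2 * Real.pi)⁻¹ * ∫ y in (closedBall x 1)ᶜ, ‖v y‖ ^ 2 / ‖x - y‖ ^ 3 := by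
  rw [truncatedPressureIntegral]
  have hint := integrableOn_pressureKernel_compl_closedBall hv hv2 x one_pos
  -- the weighted majorant is integrable on the complement (dominated by `|v|²`)
  have hmaj : IntegrableOn (fun y => ‖v y‖ ^ 2 / ‖x - y‖ ^ 3) (closedBall x 1)ᶜ := by
    have hcont : ContinuousOn (fun y => ‖v y‖ ^ 2 / ‖x - y‖ ^ 3) (closedBall x 1)ᶜ := by
      refine (hv.norm.pow 2).continuousOn.div ((continuous_const.sub continuous_id).norm.pow 3).continuousOn
        fun y hy => ?_
      rw [mem_compl_iff, mem_closedBall, not_le, dist_comm, dist_eq_norm] at hy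
      exact (pow_pos (by linarith) 3).ne'
    refine Integrable.mono' hv2.integrableOn (hcont.aestronglyMeasurable measurableSet_closedBall.compl) ?_
    refine (ae_restrict_iff' measurableSet_closedBall.compl).2 (Eventually.of_forall fun y hy => ?_)
    rw [mem_compl_iff, mem_closedBall, not_le, dist_comm, dist_eq_norm] at hy
    rw [Real.norm_eq_abs, abs_of_nonneg (by positivity)]
    exact div_le_self (sq_nonneg _) (one_le_pow₀ hy.le)
  calc |∫ y in (closedBall x 1)ᶜ, pressureKernel (x - y) (v y)|
      ≤ ∫ y in (closedBall x 1)ᶜ, |pressureKernel (x - y) (v y)| := abs_integral_le_integral_abs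
    _ ≤ ∫ y in (closedBall x 1)ᶜ, (2 * Real.pi)⁻¹ * (‖v y‖ ^ 2 / ‖x - y‖ ^ 3) := by
        refine setIntegral_mono_on hint.abs (hmaj.const_mul _) measurableSet_closedBall.compl fun y hy => ?_
        calc |pressureKernel (x - y) (v y)| ≤ ‖v y‖ ^ 2 / (2 * Real.pi * ‖x - y‖ ^ 3) := abs_pressureKernel_le _ _
          _ = (2 * Real.pi)⁻¹ * (‖v y‖ ^ 2 / ‖x - y‖ ^ 3) := by ring
    _ = (2 * Real.pi)⁻¹ * ∫ y in (closedBall x 1)ᶜ, ‖v y‖ ^ 2 / ‖x - y‖ ^ 3 := integral_const_mul _ _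

/-- **Pointwise normalised-pressure bound, weighted far field (unit scale).**  For `v ∈ C¹(ℝ³; ℝ³)` with `∫|v|² < ∞`, `|v| ≤ M₀` and
`‖Dv‖ ≤ M₁` on `B̄(x, 1)`: `|p̃[v](x)| ≤ M₀²/3 + 8M₀M₁ + (2π)⁻¹ ∫_{|y−x|>1} |v y|²/|x−y|³`. -/
theorem abs_normalisedPressure_le_weighted (hv : ContDiff ℝ 1 v) (hE : (∫⁻ x, ‖v x‖ₑ ^ 2) < ⊤)
    (x : EuclideanSpace ℝ (Fin 3)) {M₀ M₁ : ℝ}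
    (hM₀ : ∀ y ∈ closedBall x 1, ‖v y‖ ≤ M₀) (hM₁ : ∀ y ∈ closedBall x 1, ‖fderiv ℝ v y‖ ≤ M₁) :
    |normalisedPressure v x| ≤
      M₀ ^ 2 / 3 + 8 * M₀ * M₁ + (2 * Real.pi)⁻¹ * ∫ y in (closedBall x 1)ᶜ, ‖v y‖ ^ 2 / ‖x - y‖ ^ 3 := by
  have hv2 : Integrable fun y => ‖v y‖ ^ 2 := integrable_sq_of_lintegral_enorm_sq_lt_top hv.continuous hE
  have hM₁0 : 0 ≤ M₁ := (norm_nonneg _).trans (hM₁ x (mem_closedBall_self zero_le_one))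
  have hLip : ∀ y ∈ closedBall x 1, ‖v y - v x‖ ≤ M₁ * ‖y - x‖ := fun y hy =>
    (convex_closedBall x 1).norm_image_sub_le_of_norm_fderiv_le
      (fun z _ => hv.differentiable one_ne_zero z) hM₁ (mem_closedBall_self zero_le_one) hy
  obtain ⟨L, hPV, hp⟩ := normalisedPressure_eq_of_contDiff hv hE x
  set W : ℝ := (2 * Real.pi)⁻¹ * ∫ y in (closedBall x 1)ᶜ, ‖v y‖ ^ 2 / ‖x - y‖ ^ 3 with hW
  set B : ℝ := 8 * M₀ * M₁ + W with hB
  -- the truncated integrals are bounded by `B` for `0 < ε ≤ 1`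
  have hev : ∀ᶠ ε in 𝓝[>] (0 : ℝ), |truncatedPressureIntegral v x ε| ≤ B := by
    filter_upwards [Ioc_mem_nhdsGT one_pos] with ε hε
    have hshell : |truncatedPressureIntegral v x ε - truncatedPressureIntegral v x 1| ≤ 8 * M₀ * M₁ * (1 - ε) :=
      abs_truncatedPressureIntegral_sub_le hv hv2 hM₀ hLip hM₁0 hε.1 hε.2 le_rfl
    have hM₀0 : 0 ≤ M₀ := (norm_nonneg _).trans (hM₀ x (mem_closedBall_self zero_le_one))
    have hshell' : 8 * M₀ * M₁ * (1 - ε) ≤ 8 * M₀ * M₁ := by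
      have h8 : 0 ≤ 8 * M₀ * M₁ := by positivity
      nlinarith [hε.1]
    have hfar := abs_truncatedPressureIntegral_one_le_weighted hv.continuous hv2 x
    calc |truncatedPressureIntegral v x ε|
        = |(truncatedPressureIntegral v x ε - truncatedPressureIntegral v x 1) + truncatedPressureIntegral v x 1| := by
          rw [sub_add_cancel]
      _ ≤ 8 * M₀ * M₁ * (1 - ε) + W := (abs_add_le _ _).trans (add_le_add hshell hfar)
      _ ≤ B := by rw [hB]; linarith
  have hL : |L| ≤ B := le_of_tendsto hPV.2.abs hev
  have hloc : ‖v x‖ ^ 2 ≤ M₀ ^ 2 :=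
    pow_le_pow_left₀ (norm_nonneg _) (hM₀ x (mem_closedBall_self zero_le_one)) 2
  rw [hp]
  calc |-‖v x‖ ^ 2 / 3 + L| ≤ |-‖v x‖ ^ 2 / 3| + |L| := abs_add_le _ _
    _ = ‖v x‖ ^ 2 / 3 + |L| := by
        rw [abs_div, abs_neg, abs_of_nonneg (sq_nonneg _), abs_of_pos (by norm_num : (0:ℝ) < 3)]
    _ ≤ M₀ ^ 2 / 3 + B := add_le_add (by linarith) hL
    _ = _ := by rw [hB, hW]; ring

/-- the far weighted integrand transforms exactly under `y = x + δ y'` (Jacobian `δ³` against the weight `|x−y|⁻³`). -/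
theorem indicator_weightedFar_comp_affine (v : EuclideanSpace ℝ (Fin 3) → EuclideanSpace ℝ (Fin 3))
    (x : EuclideanSpace ℝ (Fin 3)) {δ : ℝ} (hδ : 0 < δ) :
    (closedBall (0 : EuclideanSpace ℝ (Fin 3)) 1)ᶜ.indicator (fun y => ‖v (x + δ • y)‖ ^ 2 / ‖(0 : EuclideanSpace ℝ (Fin 3)) - y‖ ^ 3) =
      fun y => δ ^ 3 * (closedBall x δ)ᶜ.indicator (fun z => ‖v z‖ ^ 2 / ‖x - z‖ ^ 3) (x + δ • y) := by
  funext y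
  have hmem : y ∈ (closedBall (0 : EuclideanSpace ℝ (Fin 3)) 1)ᶜ ↔ x + δ • y ∈ (closedBall x δ)ᶜ := by
    simp only [mem_compl_iff, mem_closedBall, dist_eq_norm, sub_zero, add_sub_cancel_left, norm_smul,
      Real.norm_of_nonneg hδ.le, not_le]
    constructor
    · intro h; nlinarith
    · intro h; nlinarith
  by_cases hy : y ∈ (closedBall (0 : EuclideanSpace ℝ (Fin 3)) 1)ᶜ
  · rw [indicator_of_mem hy, indicator_of_mem (hmem.1 hy)]
    have hy1 : 0 < ‖y‖ := by
      have : 1 < ‖y‖ := by simpa [mem_closedBall, dist_eq_norm] using hy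
      linarith
    rw [zero_sub, norm_neg, sub_add_cancel_left, norm_neg, norm_smul, Real.norm_of_nonneg hδ.le, mul_pow]
    field_simp
  · rw [indicator_of_notMem hy, indicator_of_notMem (fun h => hy (hmem.2 h)), mul_zero]

/-- the weighted far integral is invariant under `y = x + δ y'`. -/
theorem weightedFar_comp_affine (v : EuclideanSpace ℝ (Fin 3) → EuclideanSpace ℝ (Fin 3))
    (x : EuclideanSpace ℝ (Fin 3)) {δ : ℝ} (hδ : 0 < δ) :
    ∫ y in (closedBall (0 : EuclideanSpace ℝ (Fin 3)) 1)ᶜ, ‖v (x + δ • y)‖ ^ 2 / ‖(0 : EuclideanSpace ℝ (Fin 3)) - y‖ ^ 3 =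
      ∫ z in (closedBall x δ)ᶜ, ‖v z‖ ^ 2 / ‖x - z‖ ^ 3 := by
  rw [← integral_indicator measurableSet_closedBall.compl, ← integral_indicator measurableSet_closedBall.compl,
    indicator_weightedFar_comp_affine v x hδ, integral_const_mul]
  set F : EuclideanSpace ℝ (Fin 3) → ℝ := (closedBall x δ)ᶜ.indicator fun z => ‖v z‖ ^ 2 / ‖x - z‖ ^ 3 with hF
  have h1 : ∫ y, F (x + δ • y) = |(δ ^ 3)⁻¹| * ∫ w, F w := by
    have := Measure.integral_comp_smul volume (fun w => F (x + w)) δ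
    simp only [smul_eq_mul, finrank_euclideanSpace_fin] at this
    rw [this, integral_add_left_eq_self]
  rw [h1, ← mul_assoc, abs_of_pos (inv_pos.2 (pow_pos hδ _)), mul_inv_cancel₀ (pow_ne_zero _ hδ.ne'), one_mul]

/-- **Pointwise normalised-pressure bound, weighted far field, scale `δ`.**  For `v ∈ C¹(ℝ³; ℝ³)` with `∫|v|² < ∞`, `|v| ≤ M₀` and
`‖Dv‖ ≤ M₁` on `B̄(x, δ)`: `|p̃[v](x)| ≤ M₀²/3 + 8M₀M₁δ + (2π)⁻¹ ∫_{|y−x|>δ} |v y|²/|x−y|³` (affine covariance of `p̃`). -/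
theorem abs_normalisedPressure_le_weighted_scale (hv : ContDiff ℝ 1 v) (hE : (∫⁻ x, ‖v x‖ₑ ^ 2) < ⊤)
    (x : EuclideanSpace ℝ (Fin 3)) {δ M₀ M₁ : ℝ} (hδ : 0 < δ)
    (hM₀ : ∀ y ∈ closedBall x δ, ‖v y‖ ≤ M₀) (hM₁ : ∀ y ∈ closedBall x δ, ‖fderiv ℝ v y‖ ≤ M₁) :
    |normalisedPressure v x| ≤
      M₀ ^ 2 / 3 + 8 * M₀ * M₁ * δ + (2 * Real.pi)⁻¹ * ∫ y in (closedBall x δ)ᶜ, ‖v y‖ ^ 2 / ‖x - y‖ ^ 3 := by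
  set w : EuclideanSpace ℝ (Fin 3) → EuclideanSpace ℝ (Fin 3) := fun y => v (x + δ • y) with hw
  have hA : ContDiff ℝ 1 fun y : EuclideanSpace ℝ (Fin 3) => x + δ • y := contDiff_const.add (contDiff_const_smul δ)
  have hwc : ContDiff ℝ 1 w := hv.comp hA
  have hEw : (∫⁻ y, ‖w y‖ₑ ^ 2) < ⊤ := by
    have h1 : (fun y => ‖w y‖ₑ ^ 2) = fun y => (fun z => ‖v z‖ₑ ^ 2) (δ • y + x) := by
      funext y; simp only [hw, add_comm]
    rw [h1]
    exact (PoincareBall.lintegral_comp_smul_add (fun z => ‖v z‖ₑ ^ 2) hδ.ne' x).trans_lt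
      (ENNReal.mul_lt_top ENNReal.ofReal_lt_top hE)
  have hmaps : ∀ y ∈ closedBall (0 : EuclideanSpace ℝ (Fin 3)) 1, x + δ • y ∈ closedBall x δ := by
    intro y hy
    rw [mem_closedBall, dist_eq_norm, add_sub_cancel_left, norm_smul, Real.norm_of_nonneg hδ.le]
    have : ‖y‖ ≤ 1 := by simpa [mem_closedBall, dist_eq_norm] using hy
    nlinarith
  have hM₀' : ∀ y ∈ closedBall (0 : EuclideanSpace ℝ (Fin 3)) 1, ‖w y‖ ≤ M₀ := fun y hy => hM₀ _ (hmaps y hy)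
  have hM₁' : ∀ y ∈ closedBall (0 : EuclideanSpace ℝ (Fin 3)) 1, ‖fderiv ℝ w y‖ ≤ M₁ * δ := by
    intro y hy
    have hAy : HasFDerivAt (fun y : EuclideanSpace ℝ (Fin 3) => x + δ • y)
        (δ • ContinuousLinearMap.id ℝ (EuclideanSpace ℝ (Fin 3))) y :=
      ((hasFDerivAt_id y).const_smul δ).const_add x
    have hcomp : HasFDerivAt w
        ((fderiv ℝ v (x + δ • y)).comp (δ • ContinuousLinearMap.id ℝ (EuclideanSpace ℝ (Fin 3)))) y :=
      ((hv.differentiable one_ne_zero) (x + δ • y)).hasFDerivAt.comp y hAy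
    rw [hcomp.fderiv, ContinuousLinearMap.comp_smul, ContinuousLinearMap.comp_id, norm_smul,
      Real.norm_of_nonneg hδ.le, mul_comm]
    exact mul_le_mul_of_nonneg_right (hM₁ _ (hmaps y hy)) hδ.le
  have hp : normalisedPressure v x = normalisedPressure w 0 := by
    rw [hw, normalisedPressure_comp_affine v x hδ 0, smul_zero, add_zero]
  have h1 := abs_normalisedPressure_le_weighted hwc hEw 0 hM₀' hM₁'
  rw [weightedFar_comp_affine v x hδ] at h1
  rw [hp]
  calc |normalisedPressure w 0| ≤ _ := h1
    _ = _ := by ring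

end Summit.NavierStokesRegularity.NavierStokesRegularity.Theorems.ScalingDefectPeepholeDoor

end
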